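/-
Origin: expansion seat `planner-pub-hodgecm-toy2-0`, handover #2 2026-08-18T03:32:46Z (`HOME/pub-hodgecm-toy2/lean/Models/NonVacuity.lean`, md5 5d5bda97, 257 lines);
landed by the gen-5 packager in gate run 18 as `HodgeCM/Model/NonVacuity.lean` (import ^import Models\.→import HodgeCM.Model. ×1; run-18 rename map ×42).
-/
/-
Copyright: pub-hodgecm formalisation cell (harness21, 2026). New file (not vendored).
Origin: HOME/pub-hodgecm-toy2/lean/Models/NonVacuity.lean (WIP module `Models.NonVacuity`; intended final place
`HodgeCM/Model/NonVacuity.lean` = module `HodgeCM.Model.NonVacuity`, CONTRIBUTING §3 L5) (seat planner-pub-hodgecm-toy2-0,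
consistency seat 2, part (6a)(ii): the open inputs carry content — separating models).
-/
import Summits.HodgeConjecture.HodgeCM.Model.Inhabited
import Summits.HodgeConjecture.HodgeCM.Assembly.CorCMThetaPrime

/-!
# Non-vacuity of the open inputs: separating models

Throughout, `U⁰ := U.periodFree` is the period-free shadow (`Models.PeriodFree`: same data as `U`, `tr := 0`).
Everything here is a THEOREM about arbitrary universes; no concrete model is built (the sibling seat
`pub-hodgecm-toy` builds one, which has `tr = 0` and is therefore its own shadow).

## 1. The record `Universe.OpenInputs` (headline `COR_CM_of_openInputs`, `perL_of_openInputs`)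

* `separating_realisation` — for every `U ⊨ ModelAxioms`: `U⁰ ⊨ ModelAxioms`, `U⁰` has the SAME truth value as
  `U` for `HC_CM`, `PohlmannSpan`, `Qw8Sufficiency`, `W_RK4`, and `U⁰ ⊨ ¬RealisationExistsFace ∧ ¬PeriodThmF`
  OUTRIGHT; and, granted `PerLHypothesesInhabited`, `U⁰ ⊨ ¬RealisationExistsPerL ∧ ¬PerL ∧ ¬PerL44`.
* `exists_model_not_realisation` — hence `(∃ U, ModelAxioms ∧ OpenInputs) → ∃ U', ModelAxioms ∧ PohlmannSpan ∧
  Qw8Sufficiency ∧ HC_CM ∧ ¬RealisationExistsFace ∧ ¬PeriodThmF` (+ the PerL clause): the realisation inputs are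
  NOT consequences of the 28 model facts together with the two reduction inputs and COR-CM's conclusion.  In
  particular the headline `perL (M) (hR)` does not follow from `M` — its content is in `hR`.
* NOT separated here: `pohlmann_span`, `qw8_sufficiency`.  A separating model must change `alg` or `hodge` on CM
  products, and no transformation of an ABSTRACT `U` can: shrinking `alg` must re-establish `Fact_algDuality` (whose
  duality `D` is an opaque existential of `U`), `Fact_cup_alg`, `Fact_gysin_surface`; flattening `hodge` in degree
  `≥ 2` contradicts `Fact_cup2_hodge` with the honest `H¹`; `cup := 0` contradicts `Fact_H4_span` + `Fact_weilLine_rank`.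
  An honest separating model is a concrete universe with a NON-algebraic Hodge class (a model of `ModelAxioms ∧
  ¬HC_CM`), i.e. the exterior model with a smaller `alg` — out of reach of this seat (see TOY2.md).  (`PohlmannSpan` is
  a published theorem, Pohlmann 1968 / Gao–Ullmo 2025 Thm 3.1; `Qw8Sufficiency` is internal and is being split by
  the `qw8`/`qw8b` seats.)

## 2. The theta-reduced record `Assembly.OpenInputsTheta'` (headline `COR_CM_of_openInputsTheta'`)

Here the realisation inputs are replaced by `T.Inputs` (ten facts of a theta model `T`; from gate run 18 on the record
is `ThetaModel.Inputs` and the six PerL-internal facts are `Open_…`, the two sign constraints `Design_…` — this file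
is written against the run-17 names and is renamed mechanically at intake), `Fact_hodgeRiemann20` and
`Lemma33bLandherr`.  Of these, only `Fact_innerEmb` (Petersson = cup pairing) and `Fact_hodgeRiemann20` mention the
trace.  A theta model over `U` IS a theta model over `U⁰` (`ThetaModel.toPeriodFree`, all data verbatim), and:

* `toPeriodFree_*_iff` — the nine trace-free theta facts (`embCover`, `kappaConj`, `frameSignConj`, `thetaSub`,
  `thetaWedge`, `thetaGen12`, `thetaReal34`, `chars`, `occ`) hold for `T` over `U⁰` iff they hold over `U` (literally,
  up to re-packing the structure `GoodCtx`);
* `periodFree_fact_innerEmb_iff` — over `U⁰`, `Fact_innerEmb` holds iff `emb` kills `F²H²` of every `P_Γ`;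
* `periodFree_not_hodgeRiemann_of_thetaWedge` — over `U⁰` (for `U ⊨ ModelAxioms`, given `Lemma33bLandherr`), the
  sign facts + `thetaSub` + `thetaWedge` REFUTE `Fact_hodgeRiemann20` (the nonzero wedge of Prop 4.3 is a nonzero
  holomorphic 2-form on a surface all of whose periods vanish); hence `periodFree_not_thetaInputs_and_hodgeRiemann :
  ¬ (T'.Axioms ∧ U⁰.Fact_hodgeRiemann20)` for EVERY theta model `T'` over `U⁰`;
* `separating_theta` — if `(U, T) ⊨ ModelAxioms ∧ T.Inputs ∧ Fact_hodgeRiemann20` (the intended situation) then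
  `(U⁰, T) ⊨ ModelAxioms ∧` the nine trace-free facts `∧ ¬Fact_innerEmb ∧ ¬Fact_hodgeRiemann20`.  So NEITHER of the
  two print facts tying the automorphic side to the period (`innerEmb`, `hodgeRiemann20`) is a consequence of the 28
  model facts and the other nine theta facts: they are where the period content of PerL enters the reduced record.

`Lemma33bLandherr` and `LevelDirected` are `U`-free statements of algebra (the latter proved, `HodgeCM.levelDirected`);
nothing to separate.
-/

noncomputable section

open scoped InnerProductSpace

namespace HodgeCM

open Literature.AlgebraicGeometry.Motives (CMType)

namespace Universe

variable (U : Universe)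

/-! ## 1. Separating the realisation inputs of `OpenInputs` -/

/-- **Separating model for the realisation inputs.**  For every model `U` of the 28 facts, the period-free
shadow is a model of the 28 facts with the same `HC_CM` / `PohlmannSpan` / `Qw8Sufficiency` / `W_RK4`, in which
`RealisationExistsFace` and `PeriodThmF` FAIL, and — if PerL's hypotheses are inhabited — so do
`RealisationExistsPerL`, `PerL`, `PerL44`. -/
theorem separating_realisation (M : U.ModelAxioms) :
    U.periodFree.ModelAxioms ∧
    (U.periodFree.HC_CM ↔ U.HC_CM) ∧ (U.periodFree.PohlmannSpan ↔ U.PohlmannSpan) ∧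
    (U.periodFree.Qw8Sufficiency ↔ U.Qw8Sufficiency) ∧ (U.periodFree.W_RK4 ↔ U.W_RK4) ∧
    ¬ U.periodFree.RealisationExistsFace ∧ ¬ U.periodFree.PeriodThmF ∧
    (PerLHypothesesInhabited →
      ¬ U.periodFree.RealisationExistsPerL ∧ ¬ U.periodFree.PerL ∧ ¬ U.periodFree.PerL44) :=
  ⟨M.periodFree, U.periodFree_hc_cm_iff, U.periodFree_pohlmannSpan_iff, U.periodFree_qw8Sufficiency_iff,
    U.periodFree_w_rk4_iff, U.not_realisationExistsFace_periodFree M.pull_hodge, U.not_periodThmF_periodFree,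
    fun h => ⟨fun h' => (U.periodFree_realisationExistsPerL_iff M.pull_hodge).mp h' h,
      fun h' => U.periodFree_perL_iff.mp h' h, fun h' => U.periodFree_perL44_iff.mp h' h⟩⟩

end Universe

/-- **The realisation inputs are not consequences of the rest.**  If the 28 facts and the four open inputs are
jointly satisfiable (as intended), then there is a universe satisfying the 28 facts, both reduction inputs and the
conclusion `HC_CM` of COR-CM (and `W_RK4`), in which `RealisationExistsFace` and rfwf Thm 4.1 FAIL — and, if PerL's
hypotheses are inhabited, so do `RealisationExistsPerL` and PerL (Thm 4.4 and `W_per^L`). -/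
theorem exists_model_not_realisation (h : ∃ U : Universe, U.ModelAxioms ∧ U.OpenInputs) :
    ∃ U' : Universe, U'.ModelAxioms ∧ U'.PohlmannSpan ∧ U'.Qw8Sufficiency ∧ U'.HC_CM ∧ U'.W_RK4 ∧
      ¬ U'.RealisationExistsFace ∧ ¬ U'.PeriodThmF ∧
      (PerLHypothesesInhabited → ¬ U'.RealisationExistsPerL ∧ ¬ U'.PerL ∧ ¬ U'.PerL44) := by
  obtain ⟨U, M, I⟩ := h
  obtain ⟨M', hHC, hP, hQ, hW, hF, hT, hPerL⟩ := U.separating_realisation M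
  exact ⟨U.periodFree, M', hP.mpr I.pohlmann_span, hQ.mpr I.qw8_sufficiency,
    hHC.mpr (Assembly.COR_CM_of_openInputs U M I),
    hW.mpr (Assembly.w_rk4 U M I.realisation_face), hF, hT, hPerL⟩

/-- The weaker, unconditional-in-form version: consistency of the 28 facts alone already yields a model of the
28 facts refuting `RealisationExistsFace` and rfwf Thm 4.1. -/
theorem exists_model_not_realisationFace (h : ∃ U : Universe, U.ModelAxioms) :
    ∃ U' : Universe, U'.ModelAxioms ∧ ¬ U'.RealisationExistsFace ∧ ¬ U'.PeriodThmF := by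
  obtain ⟨U, M⟩ := h
  exact ⟨U.periodFree, M.periodFree, U.not_realisationExistsFace_periodFree M.pull_hodge,
    U.not_periodThmF_periodFree⟩

/-! ## 2. The theta-reduced record -/

namespace Universe

variable {U : Universe}

namespace ThetaModel

variable (T : U.ThetaModel)

/-- A theta model over `U`, read verbatim as a theta model over the period-free shadow (all carrier types
coincide definitionally). -/
def toPeriodFree : U.periodFree.ThetaModel :=
  { HG := T.HG, emb := T.emb, cover := T.cover, kappa := T.kappa, frameSign := T.frameSign, H := T.H, CG := T.CG,
    G := T.G, SK := T.SK, SigIdx := T.SigIdx, SigIdxG := T.SigIdxG, core := T.core, t12 := T.t12, t34 := T.t34,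
    Theta := T.Theta }

/-- (Ported verbatim from the HodgeCMPerL package; no docstring in the source.) -/
theorem toPeriodFree_embCover_iff : T.toPeriodFree.Fact_embCover ↔ T.Fact_embCover := Iff.rfl
/-- (Ported verbatim from the HodgeCMPerL package; no docstring in the source.) -/
theorem toPeriodFree_kappaConj_iff : T.toPeriodFree.Design_kappaConj ↔ T.Design_kappaConj := Iff.rfl
/-- (Ported verbatim from the HodgeCMPerL package; no docstring in the source.) -/
theorem toPeriodFree_frameSignConj_iff : T.toPeriodFree.Design_frameSignConj ↔ T.Design_frameSignConj := Iff.rfl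
/-- `GoodCtx` is a structure indexed by the universe, so over the shadow it is a different (but field-by-field
identical) proposition. -/
theorem toPeriodFree_goodCtx_iff {L : CMField} (ι₁ : L →+* ℂ) (c : SeesawCtx L) :
    T.toPeriodFree.GoodCtx ι₁ c ↔ T.GoodCtx ι₁ c :=
  ⟨fun ⟨h1, h2, h3, h4⟩ => ⟨h1, h2, h3, h4⟩, fun ⟨h1, h2, h3, h4⟩ => ⟨h1, h2, h3, h4⟩⟩

/-- (Ported verbatim from the HodgeCMPerL package; no docstring in the source.) -/
theorem toPeriodFree_thetaSub_iff : T.toPeriodFree.Open_thetaSub ↔ T.Open_thetaSub :=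
  ⟨fun h _ ι₁ V c hc => h V c ((T.toPeriodFree_goodCtx_iff ι₁ c).mpr hc),
    fun h _ ι₁ V c hc => h V c ((T.toPeriodFree_goodCtx_iff ι₁ c).mp hc)⟩
/-- (Ported verbatim from the HodgeCMPerL package; no docstring in the source.) -/
theorem toPeriodFree_thetaWedge_iff : T.toPeriodFree.Open_thetaWedge ↔ T.Open_thetaWedge :=
  ⟨fun h _ ι₁ V c hc => h V c ((T.toPeriodFree_goodCtx_iff ι₁ c).mpr hc),
    fun h _ ι₁ V c hc => h V c ((T.toPeriodFree_goodCtx_iff ι₁ c).mp hc)⟩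
/-- (Ported verbatim from the HodgeCMPerL package; no docstring in the source.) -/
theorem toPeriodFree_thetaGen12_iff : T.toPeriodFree.Open_thetaGen12 ↔ T.Open_thetaGen12 :=
  ⟨fun h _ ι₁ V c hc => h V c ((T.toPeriodFree_goodCtx_iff ι₁ c).mpr hc),
    fun h _ ι₁ V c hc => h V c ((T.toPeriodFree_goodCtx_iff ι₁ c).mp hc)⟩
/-- (Ported verbatim from the HodgeCMPerL package; no docstring in the source.) -/
theorem toPeriodFree_thetaReal34_iff : T.toPeriodFree.Open_thetaReal34 ↔ T.Open_thetaReal34 :=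
  ⟨fun h _ ι₁ V c hc => h V c ((T.toPeriodFree_goodCtx_iff ι₁ c).mpr hc),
    fun h _ ι₁ V c hc => h V c ((T.toPeriodFree_goodCtx_iff ι₁ c).mp hc)⟩
/-- (Ported verbatim from the HodgeCMPerL package; no docstring in the source.) -/
theorem toPeriodFree_chars_iff : T.toPeriodFree.Open_chars ↔ T.Open_chars :=
  ⟨fun h _ ι₁ V c hc => h V c ((T.toPeriodFree_goodCtx_iff ι₁ c).mpr hc),
    fun h _ ι₁ V c hc => h V c ((T.toPeriodFree_goodCtx_iff ι₁ c).mp hc)⟩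
/-- (Ported verbatim from the HodgeCMPerL package; no docstring in the source.) -/
theorem toPeriodFree_occ_iff : T.toPeriodFree.Open_occ ↔ T.Open_occ :=
  ⟨fun h _ ι₁ V c hc => h V c ((T.toPeriodFree_goodCtx_iff ι₁ c).mpr hc),
    fun h _ ι₁ V c hc => h V c ((T.toPeriodFree_goodCtx_iff ι₁ c).mp hc)⟩

end ThetaModel

/-- Over the period-free shadow, `Fact_innerEmb` (Petersson = cup pairing) holds iff the Matsushima embedding
KILLS every class in `F²H²(P_Γ)`. -/
theorem periodFree_fact_innerEmb_iff (T : U.periodFree.ThetaModel) :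
    T.Fact_innerEmb ↔ ∀ {L : CMField} {ι₁ : L →+* ℂ} {V : HermSpace3 L ι₁} (Γ : Level V)
      (η : U.CohC (U.pms L ι₁ V Γ) 2), η ∈ (U.hodge (U.pms L ι₁ V Γ) 2).F 2 → T.emb Γ η = 0 := by
  constructor
  · intro h L ι₁ V Γ η hη
    obtain ⟨c, -, hc⟩ := h Γ
    have key := hc η η hη hη
    rw [periodFree_trC, LinearMap.zero_apply, mul_zero] at key
    exact inner_self_eq_zero.mp key
  · intro h L ι₁ V Γ
    refine ⟨1, one_ne_zero, fun η η' hη hη' => ?_⟩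
    rw [h Γ η hη, h Γ η' hη', inner_zero_left, periodFree_trC, LinearMap.zero_apply, mul_zero]

/-- Over the period-free shadow of a model of the 28 facts (given Landherr's lemma), for EVERY theta model: the
sign facts, the typing of theta one-forms (`thetaSub`, L3.3(a) + Prop 2.2) and Prop 4.3 on forms (`thetaWedge`)
REFUTE Hodge–Riemann in bidegree `(2,0)`: at the face datum of `ℚ(ζ₇)` (with Landherr's hermitian space and the
constructed seesaw datum) Prop 4.3 yields a nonzero class `ω₁ ∪ ω₂ ∈ F²H²(P_Γ)` on a surface whose trace is `0`. -/
theorem periodFree_not_hodgeRiemann_of_thetaWedge (M : U.ModelAxioms) (hL : Lemma33bLandherr)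
    (T : U.periodFree.ThetaModel) (hκ : T.Design_kappaConj) (hs : T.Design_frameSignConj)
    (hsub : T.Open_thetaSub) (hw : T.Open_thetaWedge) : ¬ U.periodFree.Fact_hodgeRiemann20 := by
  intro hHR
  obtain ⟨F, -, h6, f, ι₁, hadm⟩ := faceHypothesesInhabited
  obtain ⟨V⟩ := landherr_exists_proof F ι₁
  obtain ⟨D, hD⟩ := T.exists_seesawDatum hκ hs hL (RingHom.id F) ι₁ f.psi (pairSum_psi f)
  let c : SeesawCtx F := ⟨F, f.psi, ι₁, D⟩
  have hc : T.GoodCtx ι₁ c :=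
    ⟨pairSum_psi f, StubTree.psi_injective F f, admissible_mem_psi f ι₁ hadm, ⟨RingHom.id F, RingHom.comp_id ι₁, hD⟩⟩
  obtain ⟨Γ, ω₁, h₁, ω₂, h₂, hne⟩ := hw V c hc
  have hH10 : ∀ i, ∀ ω ∈ T.Theta V c i Γ, ω ∈ U.periodFree.H10 (U.periodFree.pms F ι₁ V Γ) :=
    fun i ω hω => U.periodFree.Uiso_le_H10 M.pull_hodge Γ F (f.psi i) ι₁ (hsub V c hc i Γ hω)
  exact hHR _ (M.pms_dim F ι₁ V Γ) _ (cup2C_mem_F2 M.periodFree _ (hH10 0 ω₁ h₁) (hH10 1 ω₂ h₂)) hne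
    (by rw [periodFree_trC, LinearMap.zero_apply])

/-- Hence, over the period-free shadow of a model of the 28 facts (given Landherr's lemma), NO theta model
satisfies `Axioms ∧ Fact_hodgeRiemann20`. -/
theorem periodFree_not_thetaInputs_and_hodgeRiemann (M : U.ModelAxioms) (hL : Lemma33bLandherr)
    (T : U.periodFree.ThetaModel) : ¬ (T.Inputs ∧ U.periodFree.Fact_hodgeRiemann20) := fun h =>
  periodFree_not_hodgeRiemann_of_thetaWedge M hL T h.1.kappaConj h.1.frameSignConj h.1.thetaSub h.1.thetaWedge
    h.2

/-- The same conclusion through the headline route: `realisationExistsFace_of'` would give the open input that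
`Models.Inhabited` refutes in the shadow. -/
theorem periodFree_not_thetaInputs_and_hodgeRiemann' (M : U.ModelAxioms) (hL : Lemma33bLandherr)
    (T : U.periodFree.ThetaModel) : ¬ (T.Inputs ∧ U.periodFree.Fact_hodgeRiemann20) := fun h =>
  U.not_realisationExistsFace_periodFree M.pull_hodge (T.realisationExistsFace_of' M.periodFree h.1 h.2 hL)

/-- **Separating model for the pair (`Fact_innerEmb`, `Fact_hodgeRiemann20`).**  If `(U, T)` satisfies the 28
facts, the ten theta facts and Hodge–Riemann `(2,0)` (with Landherr's lemma), then `(U⁰, T)` satisfies the 28 facts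
and the NINE trace-free theta facts, and REFUTES both `Fact_innerEmb` and `Fact_hodgeRiemann20`. -/
theorem separating_theta (M : U.ModelAxioms) (hL : Lemma33bLandherr) (T : U.ThetaModel) (A : T.Inputs)
    (hHR : U.Fact_hodgeRiemann20) :
    U.periodFree.ModelAxioms ∧
    (T.toPeriodFree.Fact_embCover ∧ T.toPeriodFree.Design_kappaConj ∧ T.toPeriodFree.Design_frameSignConj ∧
      T.toPeriodFree.Open_thetaSub ∧ T.toPeriodFree.Open_thetaWedge ∧ T.toPeriodFree.Open_thetaGen12 ∧
      T.toPeriodFree.Open_thetaReal34 ∧ T.toPeriodFree.Open_chars ∧ T.toPeriodFree.Open_occ) ∧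
    ¬ T.toPeriodFree.Fact_innerEmb ∧ ¬ U.periodFree.Fact_hodgeRiemann20 := by
  refine ⟨M.periodFree, ⟨A.embCover, A.kappaConj, A.frameSignConj, T.toPeriodFree_thetaSub_iff.mpr A.thetaSub,
    T.toPeriodFree_thetaWedge_iff.mpr A.thetaWedge, T.toPeriodFree_thetaGen12_iff.mpr A.thetaGen12,
    T.toPeriodFree_thetaReal34_iff.mpr A.thetaReal34, T.toPeriodFree_chars_iff.mpr A.chars,
    T.toPeriodFree_occ_iff.mpr A.occ⟩, fun hI => ?_,
    periodFree_not_hodgeRiemann_of_thetaWedge M hL T.toPeriodFree A.kappaConj A.frameSignConj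
      (T.toPeriodFree_thetaSub_iff.mpr A.thetaSub) (T.toPeriodFree_thetaWedge_iff.mpr A.thetaWedge)⟩
  -- `innerEmb` over the shadow would make `emb` kill `F²H²`, but in `U` the wedge of Prop 4.3 has `emb ≠ 0`
  obtain ⟨F, -, h6, f, ι₁, hadm⟩ := faceHypothesesInhabited
  obtain ⟨V⟩ := landherr_exists_proof F ι₁
  obtain ⟨D, hD⟩ := T.exists_seesawDatum A.kappaConj A.frameSignConj hL (RingHom.id F) ι₁ f.psi (pairSum_psi f)
  let c : SeesawCtx F := ⟨F, f.psi, ι₁, D⟩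
  have hc : T.GoodCtx ι₁ c :=
    ⟨pairSum_psi f, StubTree.psi_injective F f, admissible_mem_psi f ι₁ hadm, ⟨RingHom.id F, RingHom.comp_id ι₁, hD⟩⟩
  obtain ⟨Γ, ω₁, h₁, ω₂, h₂, hne⟩ := A.thetaWedge V c hc
  have hH10 : ∀ i, ∀ ω ∈ T.Theta V c i Γ, ω ∈ U.H10 (U.pms F ι₁ V Γ) :=
    fun i ω hω => U.Uiso_le_H10 M.pull_hodge Γ F (f.psi i) ι₁ (A.thetaSub V c hc i Γ hω)
  have hF2 := cup2C_mem_F2 M _ (hH10 0 ω₁ h₁) (hH10 1 ω₂ h₂)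
  exact T.emb_ne_zero M A.innerEmb hHR Γ hF2 hne ((periodFree_fact_innerEmb_iff T.toPeriodFree).mp hI Γ _ hF2)

end Universe

/-- **`Fact_innerEmb` and `Fact_hodgeRiemann20` are not consequences of the rest of the theta-reduced record.**
If the 28 facts, the ten theta facts and Hodge–Riemann `(2,0)` are jointly satisfiable (as intended) and Landherr's
lemma holds, then there are a universe and a theta model satisfying the 28 facts and the nine trace-free theta
facts in which BOTH `Fact_innerEmb` and `Fact_hodgeRiemann20` fail (and `RealisationExistsFace`, rfwf Thm 4.1 fail). -/
theorem exists_model_not_innerEmb_hodgeRiemann (hL : Lemma33bLandherr)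
    (h : ∃ (U : Universe) (T : U.ThetaModel), U.ModelAxioms ∧ T.Inputs ∧ U.Fact_hodgeRiemann20) :
    ∃ (U' : Universe) (T' : U'.ThetaModel), U'.ModelAxioms ∧
      (T'.Fact_embCover ∧ T'.Design_kappaConj ∧ T'.Design_frameSignConj ∧ T'.Open_thetaSub ∧ T'.Open_thetaWedge ∧
        T'.Open_thetaGen12 ∧ T'.Open_thetaReal34 ∧ T'.Open_chars ∧ T'.Open_occ) ∧
      ¬ T'.Fact_innerEmb ∧ ¬ U'.Fact_hodgeRiemann20 ∧ ¬ U'.RealisationExistsFace ∧ ¬ U'.PeriodThmF := by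
  obtain ⟨U, T, M, A, hHR⟩ := h
  obtain ⟨M', nine, hI, hH⟩ := Universe.separating_theta M hL T A hHR
  exact ⟨U.periodFree, T.toPeriodFree, M', nine, hI, hH, U.not_realisationExistsFace_periodFree M.pull_hodge,
    U.not_periodThmF_periodFree⟩

end HodgeCM

end
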